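import Literature.NumberTheory.GaloisRepresentations.ContinuousShapiroLiftCores
import HarnessLib

/-!
# Functoriality of `Maps(G ⧸ N, ·)`, of the Shapiro lift and of the summed pairing in the COEFFICIENT module

Generic continuous group cohomology (no number theory); namespace `Literature.NumberTheory.GaloisRepresentations`.
Definitions with bodies and theorems; NO named fact, no `sorry`, no instance, no notation.  Sequel of
`ContinuousShapiroLift.lean` / `ContinuousShapiroLiftPairing.lean` / `ContinuousShapiroLiftCores.lean`.

For a morphism `f : X ⟶ Y` of topological representations of `G` and a subgroup `N ≤ G`:

* `subgroupRepMap f N : X|_N ⟶ Y|_N` (the same map, `N`-equivariant) and `coindFinMap f N : Maps(G ⧸ N, X) ⟶ Maps(G ⧸ N, Y)`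
  (post-composition `φ ↦ f ∘ φ`), with unfolding lemmas;
* **`shapiroLift_cohomologyMap`** — the Shapiro lift is natural in the coefficients:
  `Sh_N (H¹(f|_N) c) = H¹(coindFinMap f) (Sh_N c)` (on cocycles `f(s(y) • φ(⋯)) = s(y) • f(φ(⋯))`, ON THE NOSE);
* **`ContPairing.cupProduct_coindFin_map`** — the summed pairings are natural: if `g⟨x, x'⟩₁ = ⟨f x, f' x'⟩₂` then
  `H²(g)(a ∪_{Σ₁} b) = H¹(coindFinMap f) a ∪_{Σ₂} H¹(coindFinMap f') b` (the tree's `ContPairing.cupProduct_map` with the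
  module identity `g(Σ_y ⟨φ y, ψ y⟩) = Σ_y ⟨f(φ y), f'(ψ y)⟩`).

Consumer: the LEVEL COMPATIBILITY (`ℤ/p^{k+1} → ℤ/p^k`) of the layer pairings of crux K3 `SignedKatoDivisibilityUpToAtTwo`
(`Summits/BirchSwinnertonDyer`, `…LayerPairingPk.lean`), along the coefficient maps `[p] : E[p^{k+1}] → E[p^k]` and
`(·)^p : μ_{p^{k+1}} → μ_{p^k}`.

## References

* J. Neukirch, A. Schmidt, K. Wingberg, *Cohomology of Number Fields*, 2nd ed. (2008), I §4 (1.4.2) (naturality of cup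
  products), I §6 Prop. (1.6.4) (Shapiro). [NeukirchSchmidtWingberg2008]
* J.-P. Serre, *Local Fields* (1979), VII §5–§6. [SerreLocalFields1979]
-/

noncomputable section

open CategoryTheory

open scoped Classical

universe u v

namespace Literature.NumberTheory.GaloisRepresentations

open _root_.TopRep

variable {R : Type u} [CommRing R] [TopologicalSpace R]
variable {G : Type v} [Group G] [TopologicalSpace G] [IsTopologicalGroup G]

/-! ## §1 `f ↦ f|_N` and `f ↦ (φ ↦ f ∘ φ)` -/

section Maps

variable {X Y : TopRep.{v} R G} (f : X ⟶ Y) (N : Subgroup G)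

/-- The restriction `f|_N : X|_N ⟶ Y|_N` of a morphism of topological representations to a subgroup (same underlying map).
[cite: SerreLocalFields1979, VII §5] -/
def subgroupRepMap : subgroupRep X N ⟶ subgroupRep Y N :=
  TopRep.ofHom
    { toContinuousLinearMap := f.hom.toContinuousLinearMap
      isIntertwining' := fun n => by
        ext x
        change f.hom (X.ρ (n : G) x) = Y.ρ (n : G) (f.hom x)
        exact TopRep.hom_comm_apply f (n : G) x }

omit [TopologicalSpace G] [IsTopologicalGroup G] in
/-- Values of `subgroupRepMap`. [cite: SerreLocalFields1979, VII §5] -/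
@[simp]
theorem subgroupRepMap_apply (x : X) : (subgroupRepMap f N).hom x = f.hom x := rfl

/-- **`Maps(G ⧸ N, f)`**: post-composition `φ ↦ f ∘ φ`, a morphism `Maps(G ⧸ N, X) ⟶ Maps(G ⧸ N, Y)` (equivariant for the
diagonal actions since `f` intertwines). [cite: SerreLocalFields1979, VII §6] -/
def coindFinMap : coindFin X N ⟶ coindFin Y N :=
  TopRep.ofHom
    { toContinuousLinearMap :=
        { toFun := fun φ => fun y => f.hom (φ y)
          map_add' := fun φ ψ => funext fun y => by
            change f.hom ((φ + ψ) y) = f.hom (φ y) + f.hom (ψ y)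
            rw [Pi.add_apply, map_add]
          map_smul' := fun r φ => funext fun y => by
            change f.hom ((r • φ) y) = r • f.hom (φ y)
            rw [Pi.smul_apply, map_smul]
          cont := continuous_pi fun y => f.hom.continuous.comp (continuous_apply y) }
      isIntertwining' := fun g => by
        ext φ y
        change f.hom ((coindFin X N).ρ g φ y) = (coindFin Y N).ρ g (fun y => f.hom (φ y)) y
        rw [coindFin_ρ_apply, coindFin_ρ_apply]
        exact TopRep.hom_comm_apply f g _ }

omit [TopologicalSpace G] [IsTopologicalGroup G] in
/-- Values of `coindFinMap`: `(f ∘ φ)(y) = f(φ y)`. [cite: SerreLocalFields1979, VII §6] -/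
@[simp]
theorem coindFinMap_apply (φ : coindFin X N) (y : G ⧸ N) : (coindFinMap f N).hom φ y = f.hom (φ y) := rfl

end Maps

/-! ## §2 The Shapiro lift is natural in the coefficients -/

section ShapiroNat

variable {X Y : TopRep.{v} R G} (f : X ⟶ Y) (N : Subgroup G) (hN : IsOpen (N : Set G)) {s : G ⧸ N → G}
  (hs : ∀ x : G ⧸ N, (s x : G ⧸ N) = x) (hs1 : s ((1 : G) : G ⧸ N) = 1)

/-- **Naturality of the Shapiro cocycle in the coefficients, on the nose**:
`coindFinMap f ∘ Sh_N(φ) = Sh_N(f ∘ φ)` (`f(s(y) • φ(z)) = s(y) • f(φ(z))`). [cite: NeukirchSchmidtWingberg2008, I §6 Prop. (1.6.4)] -/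
theorem pullback_coindFinMap_shapiroCocycle (φ : contOneCocycles (subgroupRep X N)) :
    contOneCocycles.pullback (ContinuousMonoidHom.id G) (resIdHom (coindFinMap f N)) (shapiroCocycle X N hN hs φ) =
      shapiroCocycle Y N hN hs
        (contOneCocycles.pullback (ContinuousMonoidHom.id N) (resIdHom (subgroupRepMap f N)) φ) := by
  apply Subtype.ext
  ext g
  refine funext fun y => ?_
  rw [pullback_id_resIdHom_apply, coindFinMap_apply, shapiroCocycle_apply, shapiroCocycle_apply,
    pullback_id_resIdHom_apply, subgroupRepMap_apply]
  exact TopRep.hom_comm_apply f (s y) _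

/-- **`Sh_N (H¹(f|_N) c) = H¹(Maps(G ⧸ N, f)) (Sh_N c)`**: the Shapiro isomorphism on classes is natural in the coefficient
module. [cite: NeukirchSchmidtWingberg2008, I §6 Prop. (1.6.4)] -/
theorem shapiroLift_cohomologyMap (c : continuousCohomology 1 (subgroupRep X N)) :
    shapiroLift Y N hN hs hs1 (cohomologyMap (subgroupRepMap f N) 1 c) =
      cohomologyMap (coindFinMap f N) 1 (shapiroLift X N hN hs hs1 c) := by
  obtain ⟨φ, rfl⟩ := oneCocycleClass_surjective _ c
  rw [cohomologyMap_oneCocycleClass, shapiroLift_oneCocycleClass, shapiroLift_oneCocycleClass, cohomologyMap_oneCocycleClass,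
    pullback_coindFinMap_shapiroCocycle]

end ShapiroNat

/-! ## §3 The summed pairing is natural in the coefficients -/

namespace ContPairing

variable {X X' Z Y Y' Z' : TopRep.{v} R G} (P : ContPairing X X' Z) (P' : ContPairing Y Y' Z')
  (f : X ⟶ Y) (f' : X' ⟶ Y') (g : Z ⟶ Z') (N : Subgroup G) [Fintype (G ⧸ N)]

omit [TopologicalSpace G] [IsTopologicalGroup G] in
/-- The module identity: if `g⟨x, x'⟩₁ = ⟨f x, f' x'⟩₂` then `g(Σ_y ⟨φ y, ψ y⟩₁) = Σ_y ⟨f(φ y), f'(ψ y)⟩₂`.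
[cite: NeukirchSchmidtWingberg2008, I §4 (1.4.2)] -/
theorem coindFin_toLin_map (hc : ∀ x x', g.hom (P.toLin x x') = P'.toLin (f.hom x) (f'.hom x'))
    (φ : _root_.Literature.NumberTheory.GaloisRepresentations.coindFin X N)
    (ψ : _root_.Literature.NumberTheory.GaloisRepresentations.coindFin X' N) :
    g.hom ((P.coindFin N).toLin φ ψ) = (P'.coindFin N).toLin ((coindFinMap f N).hom φ) ((coindFinMap f' N).hom ψ) := by
  rw [coindFin_toLin_apply, coindFin_toLin_apply, map_sum]
  exact Finset.sum_congr rfl fun y _ => by rw [hc, coindFinMap_apply, coindFinMap_apply]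

variable [LocallyCompactSpace G]

/-- **Naturality of the cup product of the summed pairings in the coefficients**: if `g⟨x, x'⟩₁ = ⟨f x, f' x'⟩₂` then
`H²(g)(a ∪_{Σ₁} b) = H¹(Maps(G⧸N, f)) a ∪_{Σ₂} H¹(Maps(G⧸N, f')) b` (tree `ContPairing.cupProduct_map`).
[cite: NeukirchSchmidtWingberg2008, I §4 (1.4.2)] -/
theorem cupProduct_coindFin_map (hc : ∀ x x', g.hom (P.toLin x x') = P'.toLin (f.hom x) (f'.hom x'))
    (a : continuousCohomology 1 (_root_.Literature.NumberTheory.GaloisRepresentations.coindFin X N))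
    (b : continuousCohomology 1 (_root_.Literature.NumberTheory.GaloisRepresentations.coindFin X' N)) :
    cohomologyMap g 2 ((P.coindFin N).cupProduct a b) =
      (P'.coindFin N).cupProduct (cohomologyMap (coindFinMap f N) 1 a) (cohomologyMap (coindFinMap f' N) 1 b) :=
  cupProduct_map (P.coindFin N) (P'.coindFin N) (coindFinMap f N) (coindFinMap f' N) g
    (fun φ ψ => P.coindFin_toLin_map P' f f' g N hc φ ψ) a b

end ContPairing

end Literature.NumberTheory.GaloisRepresentations

end
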